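import Summits.AtomisticToContinuum.BoseEinsteinCondensation.Theses.BECConjugateDomination

/-!
# AtomisticToContinuum / BoseEinsteinCondensation — route `BECConjugateDomination`, assembly

Settles the assembly item `stmt-AtomisticToContinuum-11791` of route
`route-AtomisticToContinuum-BECConjugateDomination`: the implication
`InfraredMinimumUncertainty → PuffFloor → BoundaryTransferWeak → HardCoreExtension →
PositiveMinimiser → NearMinimiserStability → ShortDistanceCoherence → IMUChainGlue →
BoseEinsteinCondensation`.

The hypotheses of `Assembly` are, verbatim and in the same order, those of the route's deciding
theorem `closes`, so the assembly is that theorem curried; the composition is spelled out again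
below for the record: `HardCoreExtension` reduces the conjunct to ground-state BEC for the smooth
class, which `BoundaryTransferWeak` obtains from periodic BEC for the smooth class
(`SmoothPeriodicBEC`), itself the output of `IMUChainGlue` fed with `PositiveMinimiser`,
`NearMinimiserStability`, `ShortDistanceCoherence`, `PuffFloor` and `InfraredMinimumUncertainty`.
Pure logic; no analytic content lives here.
-/

namespace Summit.AtomisticToContinuum.BoseEinsteinCondensation.Theorems

/-- Settles `stmt-AtomisticToContinuum-11791` (exact signature): the assembly of route
`BECConjugateDomination`, i.e. its eight items imply the sub-problem statement
`BoseEinsteinCondensation`. Proof: `HardCoreExtension` applied to the smooth-class ground-state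
BEC produced by `BoundaryTransferWeak` from the smooth-class periodic BEC delivered by
`IMUChainGlue`. [folklore] -/
theorem becConjugateDomination_assembly_proof :
    Summit.AtomisticToContinuum.BoseEinsteinCondensation.Theses.BECConjugateDomination.Assembly := by
  unfold Theses.BECConjugateDomination.Assembly
  intro h₁ h₂ h₃ h₄ h₅ h₆ h₇ h₈
  exact h₄ (fun v hv hfin hC2 hedge => h₃ v hv (h₈ h₅ h₆ h₇ h₂ h₁ v hv hfin hC2 hedge))

end Summit.AtomisticToContinuum.BoseEinsteinCondensation.Theorems
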